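import Summits.CriticalPhenomena.CardyFormulaZ2.Theorems.CardyUniqueLimitCardyRigidityKernelODETaylor

/-!
# Test functions against asymptotic mean-value data: first- and second-order limits (line `crossing-martingale`, crux `CardyRigidity`)

Pure real analysis (Mathlib + `…KernelODETaylor`), theorems only; first file of the ANALYSIS half of the
unified stub `stub_kernelAffineCardy` (crux `CardyRigidity`, stmt-CriticalPhenomena-0746; lead
`prover-line-stmt-CriticalPhenomena-0746-0`).  The probabilistic far-field engine of the line delivers,
for every mark shape, a sequence of probability measures `ν_n` on `ℝ` (the laws of the increment of the
level-stopped modulus at mark scale `n`) carried by `[-r_n, r_n]`, `r_n → 0`, together with the moment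
asymptotics `n ∫ x dν_n → L₁`, `n² ∫ x² dν_n → L₂` (and, in the centred case, `n² ∫ x dν_n → M₁`).
Here we record what such data do to a smooth test function `φ`:

* `Mvp.eventually_abs_remainder_le` — for every `ε > 0`, eventually
  `|∫ φ(η+x) dν_n - φ η - φ' η ∫x - (φ'' η/2) ∫x²| ≤ ε ∫ x² dν_n` (`KernelODE.abs_integral_shift_sub_le`
  with the continuity of `φ''` at `η`);
* `Mvp.tendsto_first_order` — `n (∫ φ(η+x) dν_n - φ η) → φ'(η) L₁`;
* `Mvp.tendsto_second_order` — `n² (∫ φ(η+x) dν_n - φ η) → φ'(η) M₁ + (φ''(η)/2) L₂`.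

These feed the viscosity inequalities (test functions touching the unknown kernel) and, once the kernel
is smooth, the per-shape second-order identities (files `…MvpBootstrap`, `…MvpRigidity`).
-/

noncomputable section

open MeasureTheory Filter Set Topology
open scoped BigOperators

namespace Summit.CriticalPhenomena.CardyFormulaZ2.Cruxes.CardyRigidity.CrossingMartingale

namespace Mvp

/-! ### Two elementary limit lemmas -/

/-- A real sequence eventually bounded by every `ε > 0` in absolute value tends to `0`. [folklore] -/
theorem tendsto_zero_of_eventually_abs_le {a : ℕ → ℝ} (h : ∀ ε > 0, ∀ᶠ n in atTop, |a n| ≤ ε) :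
    Tendsto a atTop (𝓝 0) := by
  rw [Metric.tendsto_nhds]
  intro ε hε
  filter_upwards [h (ε / 2) (by positivity)] with n hn
  rw [Real.dist_0_eq_abs]
  linarith

/-- If `n² b_n → L` then `n b_n → 0`. [folklore] -/
theorem tendsto_mul_of_tendsto_sq_mul {b : ℕ → ℝ} {L : ℝ}
    (h : Tendsto (fun n : ℕ ↦ (n : ℝ) ^ 2 * b n) atTop (𝓝 L)) :
    Tendsto (fun n : ℕ ↦ (n : ℝ) * b n) atTop (𝓝 0) := by
  have hinv : Tendsto (fun n : ℕ ↦ ((n : ℝ))⁻¹) atTop (𝓝 0) :=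
    tendsto_inv_atTop_zero.comp tendsto_natCast_atTop_atTop
  have := h.mul hinv
  rw [mul_zero] at this
  refine this.congr' ?_
  filter_upwards [eventually_gt_atTop 0] with n hn
  have hn' : (n : ℝ) ≠ 0 := by positivity
  field_simp

/-! ### The second-order remainder against concentrated measures -/

variable {φ φ₁ φ₂ : ℝ → ℝ} {η : ℝ} {ν : ℕ → Measure ℝ} {r : ℕ → ℝ}

/-- **Remainder bound.**  For `φ` twice differentiable with continuous `φ''`, probability measures
`ν_n` carried by `[-r_n, r_n]` with `r_n → 0`, and every `ε > 0`: eventually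
`|∫ φ(η+x) dν_n - φ η - φ'(η) ∫x dν_n - (φ''(η)/2) ∫x² dν_n| ≤ ε ∫ x² dν_n`. [folklore] -/
theorem eventually_abs_remainder_le (hφ : ∀ y, HasDerivAt φ (φ₁ y) y)
    (hφ₁ : ∀ y, HasDerivAt φ₁ (φ₂ y) y) (hφ₂ : Continuous φ₂) (hr : Tendsto r atTop (𝓝 0))
    (hν : ∀ᶠ n in atTop, IsProbabilityMeasure (ν n) ∧ ν n (Icc (-(r n)) (r n))ᶜ = 0)
    {ε : ℝ} (hε : 0 < ε) :
    ∀ᶠ n in atTop, |∫ x, φ (η + x) ∂(ν n) - φ η - φ₁ η * ∫ x, x ∂(ν n) -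
        φ₂ η / 2 * ∫ x, x ^ 2 ∂(ν n)| ≤ ε * ∫ x, x ^ 2 ∂(ν n) := by
  -- continuity modulus of `φ₂` at `η`
  obtain ⟨δ, hδ, hmodδ⟩ := Metric.continuous_iff.1 hφ₂ η ε hε
  set ρ : ℝ := δ / 2 with hρ
  have hρpos : 0 < ρ := by positivity
  have hmod : ∀ x ∈ Icc (-ρ) ρ, |φ₂ (η + x) - φ₂ η| ≤ ε := by
    intro x hx
    have hdist : dist (η + x) η < δ := by
      rw [Real.dist_eq, add_sub_cancel_left, abs_lt]
      constructor <;> linarith [hx.1, hx.2]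
    have := hmodδ (η + x) hdist
    rw [Real.dist_eq] at this
    exact this.le
  have hrρ : ∀ᶠ n in atTop, r n < ρ := hr.eventually (gt_mem_nhds hρpos)
  filter_upwards [hν, hrρ] with n hn hrn
  obtain ⟨hprob, hsupp⟩ := hn
  exact KernelODE.abs_integral_shift_sub_le hε.le (fun y _ ↦ hφ y) (fun y _ ↦ hφ₁ y) hmod hrn.le hsupp

/-- The second moments are nonnegative. [folklore] -/
theorem integral_sq_nonneg (μ : Measure ℝ) : 0 ≤ ∫ x, x ^ 2 ∂μ :=
  integral_nonneg fun x ↦ sq_nonneg x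

/-! ### First order -/

/-- **First-order limit.**  With `n ∫x dν_n → L₁` and `n² ∫x² dν_n → L₂`:
`n (∫ φ(η+x) dν_n - φ η) → φ'(η) L₁`. [folklore] -/
theorem tendsto_first_order (hφ : ∀ y, HasDerivAt φ (φ₁ y) y) (hφ₁ : ∀ y, HasDerivAt φ₁ (φ₂ y) y)
    (hφ₂ : Continuous φ₂) (hr : Tendsto r atTop (𝓝 0))
    (hν : ∀ᶠ n in atTop, IsProbabilityMeasure (ν n) ∧ ν n (Icc (-(r n)) (r n))ᶜ = 0) {L₁ L₂ : ℝ}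
    (h1 : Tendsto (fun n : ℕ ↦ (n : ℝ) * ∫ x, x ∂(ν n)) atTop (𝓝 L₁))
    (h2 : Tendsto (fun n : ℕ ↦ (n : ℝ) ^ 2 * ∫ x, x ^ 2 ∂(ν n)) atTop (𝓝 L₂)) :
    Tendsto (fun n : ℕ ↦ (n : ℝ) * (∫ x, φ (η + x) ∂(ν n) - φ η)) atTop (𝓝 (φ₁ η * L₁)) := by
  -- the remainder and its decay at rate `n`
  set R : ℕ → ℝ := fun n ↦ ∫ x, φ (η + x) ∂(ν n) - φ η - φ₁ η * ∫ x, x ∂(ν n) -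
    φ₂ η / 2 * ∫ x, x ^ 2 ∂(ν n) with hR
  have h2' : Tendsto (fun n : ℕ ↦ (n : ℝ) * ∫ x, x ^ 2 ∂(ν n)) atTop (𝓝 0) :=
    tendsto_mul_of_tendsto_sq_mul h2
  have hRlim : Tendsto (fun n : ℕ ↦ (n : ℝ) * R n) atTop (𝓝 0) := by
    have hbd : ∀ᶠ n : ℕ in atTop, |(n : ℝ) * R n| ≤ (n : ℝ) * ∫ x, x ^ 2 ∂(ν n) := by
      filter_upwards [eventually_abs_remainder_le (η := η) hφ hφ₁ hφ₂ hr hν one_pos] with n hn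
      rw [abs_mul, Nat.abs_cast, one_mul] at *
      exact mul_le_mul_of_nonneg_left hn (Nat.cast_nonneg n)
    refine tendsto_zero_of_eventually_abs_le fun ε hε ↦ ?_
    filter_upwards [hbd, h2'.eventually (gt_mem_nhds hε)] with n hn hn'
    exact hn.trans hn'.le
  -- assemble
  have hlim : Tendsto (fun n : ℕ ↦ φ₁ η * ((n : ℝ) * ∫ x, x ∂(ν n)) +
      φ₂ η / 2 * ((n : ℝ) * ∫ x, x ^ 2 ∂(ν n)) + (n : ℝ) * R n) atTop
      (𝓝 (φ₁ η * L₁ + φ₂ η / 2 * 0 + 0)) :=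
    ((h1.const_mul _).add (h2'.const_mul _)).add hRlim
  rw [mul_zero, add_zero, add_zero] at hlim
  refine hlim.congr' (Eventually.of_forall fun n ↦ ?_)
  simp only [hR]
  ring

/-! ### Second order -/

/-- **Second-order limit.**  With `n² ∫x dν_n → M₁` and `n² ∫x² dν_n → L₂`:
`n² (∫ φ(η+x) dν_n - φ η) → φ'(η) M₁ + (φ''(η)/2) L₂`. [folklore] -/
theorem tendsto_second_order (hφ : ∀ y, HasDerivAt φ (φ₁ y) y) (hφ₁ : ∀ y, HasDerivAt φ₁ (φ₂ y) y)
    (hφ₂ : Continuous φ₂) (hr : Tendsto r atTop (𝓝 0))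
    (hν : ∀ᶠ n in atTop, IsProbabilityMeasure (ν n) ∧ ν n (Icc (-(r n)) (r n))ᶜ = 0) {M₁ L₂ : ℝ}
    (h1 : Tendsto (fun n : ℕ ↦ (n : ℝ) ^ 2 * ∫ x, x ∂(ν n)) atTop (𝓝 M₁))
    (h2 : Tendsto (fun n : ℕ ↦ (n : ℝ) ^ 2 * ∫ x, x ^ 2 ∂(ν n)) atTop (𝓝 L₂)) :
    Tendsto (fun n : ℕ ↦ (n : ℝ) ^ 2 * (∫ x, φ (η + x) ∂(ν n) - φ η)) atTop
      (𝓝 (φ₁ η * M₁ + φ₂ η / 2 * L₂)) := by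
  set R : ℕ → ℝ := fun n ↦ ∫ x, φ (η + x) ∂(ν n) - φ η - φ₁ η * ∫ x, x ∂(ν n) -
    φ₂ η / 2 * ∫ x, x ^ 2 ∂(ν n) with hR
  -- `L₂ ≥ 0` and the second moments are eventually below `L₂ + 1`
  have hL₂ : 0 ≤ L₂ :=
    ge_of_tendsto' h2 fun n ↦ mul_nonneg (sq_nonneg _) (integral_sq_nonneg _)
  have hbd2 : ∀ᶠ n : ℕ in atTop, (n : ℝ) ^ 2 * ∫ x, x ^ 2 ∂(ν n) < L₂ + 1 :=
    h2.eventually (gt_mem_nhds (lt_add_one L₂))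
  -- the remainder decays at rate `n²`
  have hRlim : Tendsto (fun n : ℕ ↦ (n : ℝ) ^ 2 * R n) atTop (𝓝 0) := by
    refine tendsto_zero_of_eventually_abs_le fun ε hε ↦ ?_
    have hε' : 0 < ε / (L₂ + 1) := by positivity
    filter_upwards [eventually_abs_remainder_le (η := η) hφ hφ₁ hφ₂ hr hν hε', hbd2] with n hn hn2
    rw [abs_mul, abs_of_nonneg (sq_nonneg (n : ℝ))]
    calc (n : ℝ) ^ 2 * |R n| ≤ (n : ℝ) ^ 2 * (ε / (L₂ + 1) * ∫ x, x ^ 2 ∂(ν n)) :=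
          mul_le_mul_of_nonneg_left hn (sq_nonneg _)
      _ = ε / (L₂ + 1) * ((n : ℝ) ^ 2 * ∫ x, x ^ 2 ∂(ν n)) := by ring
      _ ≤ ε / (L₂ + 1) * (L₂ + 1) := mul_le_mul_of_nonneg_left hn2.le hε'.le
      _ = ε := by field_simp
  have hlim : Tendsto (fun n : ℕ ↦ φ₁ η * ((n : ℝ) ^ 2 * ∫ x, x ∂(ν n)) +
      φ₂ η / 2 * ((n : ℝ) ^ 2 * ∫ x, x ^ 2 ∂(ν n)) + (n : ℝ) ^ 2 * R n) atTop
      (𝓝 (φ₁ η * M₁ + φ₂ η / 2 * L₂ + 0)) :=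
    ((h1.const_mul _).add (h2.const_mul _)).add hRlim
  rw [add_zero] at hlim
  refine hlim.congr' (Eventually.of_forall fun n ↦ ?_)
  simp only [hR]
  ring

/-! ### Smooth test functions -/

/-- A `C^∞` function has everywhere-defined first and second derivatives, the second one continuous
(the format of the lemmas above). [folklore] -/
theorem derivs_of_contDiff {φ : ℝ → ℝ} (hφ : ContDiff ℝ (⊤ : ℕ∞) φ) :
    (∀ y, HasDerivAt φ (deriv φ y) y) ∧ (∀ y, HasDerivAt (deriv φ) (deriv (deriv φ) y) y) ∧
      Continuous (deriv (deriv φ)) := by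
  have h1 : ContDiff ℝ (⊤ : ℕ∞) (deriv φ) := hφ.iterate_deriv 1
  have h2 : ContDiff ℝ (⊤ : ℕ∞) (deriv (deriv φ)) := hφ.iterate_deriv 2
  refine ⟨fun y ↦ ?_, fun y ↦ ?_, h2.continuous⟩
  · exact (hφ.differentiable (by simp)).differentiableAt.hasDerivAt
  · exact (h1.differentiable (by simp)).differentiableAt.hasDerivAt

/-- First-order limit for a `C^∞` test function. [folklore] -/
theorem tendsto_first_order_of_contDiff {φ : ℝ → ℝ} (hφ : ContDiff ℝ (⊤ : ℕ∞) φ)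
    (hr : Tendsto r atTop (𝓝 0))
    (hν : ∀ᶠ n in atTop, IsProbabilityMeasure (ν n) ∧ ν n (Icc (-(r n)) (r n))ᶜ = 0) {L₁ L₂ : ℝ}
    (h1 : Tendsto (fun n : ℕ ↦ (n : ℝ) * ∫ x, x ∂(ν n)) atTop (𝓝 L₁))
    (h2 : Tendsto (fun n : ℕ ↦ (n : ℝ) ^ 2 * ∫ x, x ^ 2 ∂(ν n)) atTop (𝓝 L₂)) :
    Tendsto (fun n : ℕ ↦ (n : ℝ) * (∫ x, φ (η + x) ∂(ν n) - φ η)) atTop (𝓝 (deriv φ η * L₁)) := by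
  obtain ⟨hd1, hd2, hc⟩ := derivs_of_contDiff hφ
  exact tendsto_first_order hd1 hd2 hc hr hν h1 h2

/-- Second-order limit for a `C^∞` test function. [folklore] -/
theorem tendsto_second_order_of_contDiff {φ : ℝ → ℝ} (hφ : ContDiff ℝ (⊤ : ℕ∞) φ)
    (hr : Tendsto r atTop (𝓝 0))
    (hν : ∀ᶠ n in atTop, IsProbabilityMeasure (ν n) ∧ ν n (Icc (-(r n)) (r n))ᶜ = 0) {M₁ L₂ : ℝ}
    (h1 : Tendsto (fun n : ℕ ↦ (n : ℝ) ^ 2 * ∫ x, x ∂(ν n)) atTop (𝓝 M₁))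
    (h2 : Tendsto (fun n : ℕ ↦ (n : ℝ) ^ 2 * ∫ x, x ^ 2 ∂(ν n)) atTop (𝓝 L₂)) :
    Tendsto (fun n : ℕ ↦ (n : ℝ) ^ 2 * (∫ x, φ (η + x) ∂(ν n) - φ η)) atTop
      (𝓝 (deriv φ η * M₁ + deriv (deriv φ) η / 2 * L₂)) := by
  obtain ⟨hd1, hd2, hc⟩ := derivs_of_contDiff hφ
  exact tendsto_second_order hd1 hd2 hc hr hν h1 h2

/-- **Registered form** (glue sub-goal `mvp_tendsto_second_order` of stmt-CriticalPhenomena-0746): the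
second-order limit of a smooth test function against asymptotic mean-value data. [folklore] -/
theorem mvp_tendsto_second_order : ∀ {φ : ℝ → ℝ} {η : ℝ} {ν : ℕ → MeasureTheory.Measure ℝ} {r : ℕ → ℝ} {M₁ L₂ : ℝ}, ContDiff ℝ (⊤ : ℕ∞) φ → Filter.Tendsto r Filter.atTop (nhds 0) → (∀ᶠ n in Filter.atTop, MeasureTheory.IsProbabilityMeasure (ν n) ∧ ν n (Set.Icc (-(r n)) (r n))ᶜ = 0) → Filter.Tendsto (fun n : ℕ ↦ (n : ℝ) ^ 2 * ∫ x, x ∂(ν n)) Filter.atTop (nhds M₁) → Filter.Tendsto (fun n : ℕ ↦ (n : ℝ) ^ 2 * ∫ x, x ^ 2 ∂(ν n)) Filter.atTop (nhds L₂) → Filter.Tendsto (fun n : ℕ ↦ (n : ℝ) ^ 2 * (∫ x, φ (η + x) ∂(ν n) - φ η)) Filter.atTop (nhds (deriv φ η * M₁ + deriv (deriv φ) η / 2 * L₂)) :=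
  fun hφ hr hν h1 h2 ↦ tendsto_second_order_of_contDiff hφ hr hν h1 h2

end Mvp

end Summit.CriticalPhenomena.CardyFormulaZ2.Cruxes.CardyRigidity.CrossingMartingale

end
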